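import Literature.Probability.LatticeModels.SourcedDoubleCurrentsProofs
import Literature.Probability.LatticeModels.UrsellFourCurrentsProofs
import Literature.Probability.LatticeModels.CriticalCorrWellDefined
import Literature.Probability.Percolation.PercolationProofs
import Mathlib.Combinatorics.SimpleGraph.Trails
import HarnessLib

/-!
# Switching identities for the sourced double currents of `ℤ^d`: the event `𝓕_B` on traces,
# the finite-volume identities (proved) and ADC21 (3.10)–(3.11) in infinite volume (named facts)

Topic `Probability/LatticeModels`; namespace `Literature.Probability.LatticeModels`. Definition
request `defn-sourcedDoubleCurrentLaw` (route CriticalPhenomena/CurrentConnectionInvariance, cruxes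
RatioInversionInvariance / RatioLimit / RatioRotationInvariance / NormalisedU4Nonvanishing): the
infinite-volume sourced double current `P^{A,∅}_β` **together with** the infinite-volume
source-insertion identity and the infinite-volume random-current identity for `U₄`.

The measures themselves are the tree's (`SourcedDoubleCurrents.lean`, definition request
`defn-SourcedDoubleCurrentZ3`): the finite-volume trace laws `sourcedDoubleCurrentLaw d L β A B =
P^{A,B}_{Λ_L,β}` (free boundary condition, push-forward of `doubleCurrentMeasure (freeBoxGraph d L)`
under the lifted trace `sourcedTrace`) and their weak limit on local events
`sourcedDoubleCurrentLawInf d β A B = P^{A,B}_β` (existence for every `β > 0` and `#A`, `#B` even is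
the tree THEOREM `exists_isSourcedDoubleCurrentLimit` / `sourcedDoubleCurrent_limit_exists_holds` of
`SourcedDoubleCurrentsProofs.lean`). The requested `P^{A,∅}_β` is `sourcedDoubleCurrentLawInf d β A ∅`.
This file adds what the request asks for on top of them.

## Source

M. Aizenman, H. Duminil-Copin, *Marginal triviality of the scaling limits of critical 4D Ising and
`λφ⁴₄` models*, Ann. of Math. **194** (2021) 163–235 = arXiv:1912.07973 (bib key
`AizenmanDuminilCopinAnnals2021`, "ADC21"; held, read pp. 8–9): Def. 3.2 (iii) "For a set of
vertices `B`, we denote by `𝓕_B` the set of `n` satisfying that there exists a sub-current `m ≤ n`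
such that `∂m = B`"; Lemma 3.3 (switching lemma); §3.2, (3.7)
`⟨σ_A⟩_{Λ,β}⟨σ_B⟩_{Λ,β} / ⟨σ_Aσ_B⟩_{Λ,β} = P^{A∆B,∅}_{Λ,β}[n₁+n₂ ∈ 𝓕_B]`; "As we will also work
with the infinite volume Gibbs measures, let us note that random currents and the switching lemma
admit a generalization to infinite volume [footnote 5: The extension of the switching lemma to `ℤ^d`
is straightforward for `β ≤ β_c` since then `n₁+n₂` does not contain infinite paths of positive
currents, almost surely under `P^{A,B}_β`. For `β < β_c` this is implied by the discussion of
[Aiz82], and for `β = β_c` it follows from the continuity result of [AizDumSid15].] Existing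
continuity results [AizDumSid15] permit to extend (3.7) to the infinite volume, expressed in terms
of the weak limits of the random current measures `P^A_{Λ_n,β}` and `P^{A_1,…,A_i}_{Λ_n,β}`, in the
limit `Λ_n ↗ ℤ^d`. The limiting statement is similar to (3.7) but without the finite volume
subscript `Λ`: (3.10) `⟨σ_A⟩_β⟨σ_B⟩_β / ⟨σ_Aσ_B⟩_β = P^{A∆B,∅}_β[n₁+n₂ ∈ 𝓕_B]`. Combining (3.10)
for the different values of the product of spin-spin correlations leads to (3.11)
`U₄^β(x,y,z,t) = -2⟨σ_xσ_y⟩_β⟨σ_zσ_t⟩_β P^{xy,zt}_β[C_{n₁+n₂}(x) ∩ C_{n₁+n₂}(z) ≠ ∅]`."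
(Equation numbers of the arXiv version, as in `UrsellFourCurrents.lean`.)

## Contents

* `bondDegree T x`, `oddVertices T` — the degree of a vertex in a finite set of pairs `T`
  (diagonal pairs, which are never bonds, ignored) and the set `∂𝟙_T` of its odd-degree vertices.
* **`traceSubcurrentEvent B`** — ADC21's `𝓕_B` read on the trace `ω = {e : n_e > 0}` of a current
  `n`: "`ω` contains a finite set of bonds `T` with `∂𝟙_T = B`". This IS `{n ∈ 𝓕_B}`: a
  sub-current `m ≤ n` with `∂m = B` gives `T = {e : m_e odd} ⊆ ω` with `∂𝟙_T = ∂m`, and conversely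
  `m = 𝟙_T ≤ n`; the finite-volume form of this remark is PROVED here
  (`sourcedTrace_preimage_traceSubcurrentEvent`: the pull-back of `traceSubcurrentEvent B` under
  the lifted trace is the tree's `subcurrentEvent (freeBoxGraph d L) (boxSources d L B)`).
  Measurable (`measurableSet_traceSubcurrentEvent`), increasing, `𝓕_∅ = univ`, and for a pair
  **`𝓕_{{a}∆{b}} = {a ↔ b}`** as sets of bond configurations (`traceSubcurrentEvent_pair`, from
  Mathlib's trail parity lemma and a handshake argument).
* Lifting lemmas: `liftBonds_mem_openConn_iff`, `sourcedTrace_preimage_openConn` (the pull-back of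
  `{x ↔ z}` is the tree's `tracedConn`), `isingCorr_free_box_eq_boxGraph` (free box correlations of
  `ℤ^d` are those of the free box graph).
* **Finite volume, PROVED** from the tree's discharged facts
  `isingCorr_mul_eq_doubleCurrent_subcurrent_holds` (ADC21 (3.7)) and `ursellFour_eq_doubleCurrent_holds`
  (ADC21 (3.11) on finite graphs) applied to `freeBoxGraph d L`:
  `isingCorr_free_box_mul_eq` — `⟨σ_A⟩⁰_{Λ_L}⟨σ_B⟩⁰_{Λ_L} = ⟨σ_{A∆B}⟩⁰_{Λ_L} · P^{A∆B,∅}_{Λ_L,β}[𝓕_B]`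
  for `A, B ⊆ Λ_L`, `β ≥ 0`; its pair form `isingCorr_free_box_mul_twoPoint_eq` with the event
  `{a ↔ b}`; and `connectedFour_free_box_eq` —
  `U₄,Λ_L(x,y,z,t) = -2⟨σ_xσ_y⟩⁰_{Λ_L}⟨σ_zσ_t⟩⁰_{Λ_L} · P^{{x}∆{y},{z}∆{t}}_{Λ_L,β}[x ↔ z]`.
* **Infinite volume, NAMED FACTS** (ADC21 (3.10), (3.11); nearest-neighbour model on `ℤ^d`,
  `d ≥ 2`, `0 ≤ β ≤ β_c(d)`, free state `freeCorr`/`freeExpect` = the limit of the free boundary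
  condition used in `sourcedDoubleCurrentLaw`; product form, so that no positivity hypothesis is
  needed): `freeCorr_mul_eq_sourcedDoubleCurrent_subcurrent` and
  `freeUrsellFour_eq_sourcedDoubleCurrent`. Both are the `L → ∞` limits of the proved box
  identities GRANTED the convergence `P^{A,B}_{Λ_L,β}[E] → P^{A,B}_β[E]` for the two non-local
  increasing events `E = 𝓕_B`, `{x ↔ z}`, which is where footnote 5 (no infinite cluster under
  `P^{A,B}_β`, `β ≤ β_c`) enters; that no-percolation statement is not in the tree, so the two
  displays are vendored as facts (users take `(h : freeCorr_mul_eq_sourcedDoubleCurrent_subcurrent d)`).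
* PROVED corollaries of the facts: the pair form `….pair`
  (`⟨σ_A⟩⟨σ_aσ_b⟩ = ⟨σ_{A∆{a}∆{b}}⟩ · P^{A∆{a}∆{b},∅}_β[a ↔ b]`, the route's "weight-free ratio =
  connection probability"), the ratio form `….div`, and the critical plus-state forms for `d ≥ 3`
  (`….plusCorr_criticalBeta`, `….criticalCorr_eq`: at `β_c` the free and plus states coincide,
  `m*(β_c) = 0`, tree theorems `spontaneousMagnetization_criticalBeta_eq_zero_holds`,
  `freeCorr_eq_plusCorr_of_spontaneousMagnetization_eq_zero`, `criticalCorr_wellDefined_holds`).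

## Mathlib status

No random currents in Mathlib. Anchors: `SimpleGraph.Walk.IsTrail.even_countP_edges_iff` (parity of
the degrees along a trail), `SimpleGraph.Walk.toPath`, `SimpleGraph.fromEdgeSet`,
`Finset.even_sum_iff_even_card_odd` / `Finset.odd_sum_iff_odd_card_odd`, `Sym2.mem_map`,
`Sym2.map.injective`, `measurableSet_mem`, `Filter.Tendsto.limUnder_eq`; tree: `sourcedDoubleCurrentLaw`,
`sourcedDoubleCurrentLawInf`, `boxSources`, `sourcedTrace` (`SourcedDoubleCurrents.lean`),
`subcurrentEvent`, `isingCorr_mul_eq_doubleCurrent_subcurrent_holds`, `ursellFour_eq_doubleCurrent_holds`,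
`spinMonomial_four_eq_spinProduct` (`UrsellFourCurrents(Proofs).lean`), `boxCore`, `boxEmb`,
`isingCorr_free_box_eq`, `reachable_liftBonds` (`DoubleCurrentsProofs.lean`), `boxSources_subset_boxCore`,
`map_boxSources`, `plusCurrentSum_freeBoxGraph_eq_currentSum`, `exists_isSourcedDoubleCurrentLimit`
(`SourcedDoubleCurrentsProofs.lean`), `measurableSet_openConn_holds` (`PercolationProofs.lean`).
-/

noncomputable section

open MeasureTheory Filter Topology Finset Literature.Probability.Percolation
open scoped symmDiff

namespace Literature.Probability.LatticeModels

/-! ### Odd vertices of a finite set of bonds, and `𝓕_B` read on the trace -/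

section TraceSubcurrent

variable {V : Type*} [DecidableEq V]

/-- The degree of the vertex `x` in the finite set of pairs `T`: the number of non-diagonal pairs
of `T` containing `x` (diagonal pairs `s(x,x)` are never bonds and are ignored). [folklore] -/
def bondDegree (T : Finset (Sym2 V)) (x : V) : ℕ :=
  #(T.filter fun e => x ∈ e ∧ ¬e.IsDiag)

/-- The odd-degree vertices of a finite set of pairs `T`, i.e. the sources `∂𝟙_T` of the current
`𝟙_T` (ADC21 Def. 3.1: `∂n = {x : ∑_y n(x,y) odd}`). [cite: AizenmanDuminilCopinAnnals2021, Def. 3.1] -/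
def oddVertices (T : Finset (Sym2 V)) : Finset V :=
  (T.biUnion fun e => e.toFinset).filter fun x => Odd (bondDegree T x)

/-- Membership in the filter defining `bondDegree`. [folklore] -/
theorem mem_filter_bondDegree {T : Finset (Sym2 V)} {x : V} {e : Sym2 V} :
    e ∈ T.filter (fun e => x ∈ e ∧ ¬e.IsDiag) ↔ e ∈ T ∧ x ∈ e ∧ ¬e.IsDiag :=
  Finset.mem_filter

/-- `x ∈ ∂𝟙_T ↔ deg_T(x)` is odd (an odd degree is positive, so `x` lies on a pair of `T`). [folklore] -/
theorem mem_oddVertices_iff {T : Finset (Sym2 V)} {x : V} :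
    x ∈ oddVertices T ↔ Odd (bondDegree T x) := by
  simp only [oddVertices, Finset.mem_filter, Finset.mem_biUnion, Sym2.mem_toFinset,
    and_iff_right_iff_imp]
  intro hodd
  have hpos : 0 < bondDegree T x := by
    rcases Nat.eq_zero_or_pos (bondDegree T x) with h0 | h0
    · rw [h0] at hodd; exact absurd hodd (Nat.not_odd_iff_even.2 (by decide))
    · exact h0
  obtain ⟨e, he⟩ := Finset.card_pos.1 hpos
  rw [Finset.mem_filter] at he
  exact ⟨e, he.1, he.2.1⟩

/-- The empty set of bonds has all degrees zero. [folklore] -/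
@[simp] theorem bondDegree_empty (x : V) : bondDegree (∅ : Finset (Sym2 V)) x = 0 := by
  simp [bondDegree]

/-- `∂𝟙_∅ = ∅`. [folklore] -/
@[simp] theorem oddVertices_empty : oddVertices (∅ : Finset (Sym2 V)) = ∅ := by
  simp [oddVertices]

/-- **ADC21's event `𝓕_B` read on the trace.** For a bond configuration `ω` (the trace
`{e : n_e > 0}` of a current `n`), `ω ∈ traceSubcurrentEvent B` iff `ω` contains a finite set of
bonds `T` whose odd-degree vertex set is `B` — equivalently (for `ω` the trace of `n`) "there exists a
sub-current `m ≤ n` such that `∂m = B`" (ADC21 Def. 3.2 (iii): take `T = {e : m_e odd}`, resp.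
`m = 𝟙_T`; proved in finite volume as `sourcedTrace_preimage_traceSubcurrentEvent`). For a pair
`B = {a} ∆ {b}` it is the connection event `{a ↔ b}` (`traceSubcurrentEvent_pair`). [cite: AizenmanDuminilCopinAnnals2021, Def. 3.2] -/
def traceSubcurrentEvent (B : Finset V) : Set (BondConfig V) :=
  {ω | ∃ T : Finset (Sym2 V), ↑T ⊆ ω ∧ oddVertices T = B}

/-- Membership in `traceSubcurrentEvent`. [cite: AizenmanDuminilCopinAnnals2021, Def. 3.2] -/
theorem mem_traceSubcurrentEvent_iff {B : Finset V} {ω : BondConfig V} :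
    ω ∈ traceSubcurrentEvent B ↔ ∃ T : Finset (Sym2 V), ↑T ⊆ ω ∧ oddVertices T = B :=
  Iff.rfl

/-- `𝓕_∅` is the sure event (`T = ∅`; ADC21: `m = 0`). [cite: AizenmanDuminilCopinAnnals2021, Def. 3.2] -/
theorem traceSubcurrentEvent_empty : traceSubcurrentEvent (∅ : Finset V) = Set.univ := by
  refine Set.eq_univ_of_forall fun ω => ⟨∅, by simp, oddVertices_empty⟩

/-- `𝓕_B` is increasing in the configuration. [folklore] -/
theorem isUpperSet_traceSubcurrentEvent (B : Finset V) :
    IsUpperSet (traceSubcurrentEvent B : Set (BondConfig V)) := by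
  rintro ω ω' hle ⟨T, hT, hTB⟩
  exact ⟨T, hT.trans hle, hTB⟩

/-- `𝓕_B` is measurable (`V` countable): a countable union over the finite bond sets `T` with
`∂𝟙_T = B` of the finite intersections `⋂_{e ∈ T} {e open}`. [folklore] -/
theorem measurableSet_traceSubcurrentEvent [Countable V] (B : Finset V) :
    MeasurableSet (traceSubcurrentEvent B : Set (BondConfig V)) := by
  have hset : (traceSubcurrentEvent B : Set (BondConfig V)) =
      ⋃ T : Finset (Sym2 V), ({ω : BondConfig V | (↑T : Set (Sym2 V)) ⊆ ω} ∩ {_ω | oddVertices T = B}) := by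
    ext ω
    simp only [mem_traceSubcurrentEvent_iff, Set.mem_iUnion, Set.mem_inter_iff, Set.mem_setOf_eq]
  rw [hset]
  refine MeasurableSet.iUnion fun T => MeasurableSet.inter ?_ (MeasurableSet.const _)
  have hT : {ω : BondConfig V | (↑T : Set (Sym2 V)) ⊆ ω} = ⋂ e ∈ T, {ω : BondConfig V | e ∈ ω} := by
    ext ω
    simp only [Set.mem_setOf_eq, Set.mem_iInter, Set.subset_def, Finset.mem_coe]
  rw [hT]
  exact Finset.measurableSet_biInter T fun e _ => measurableSet_mem e

/-! #### The pair case: `𝓕_{{a}∆{b}} = {a ↔ b}` -/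

omit [DecidableEq V] in
/-- Pairs lying on a walk of a simple graph are not diagonal. [folklore] -/
theorem not_isDiag_of_mem_walk_edges {G : SimpleGraph V} {u v : V} (p : G.Walk u v) {e : Sym2 V}
    (he : e ∈ p.edges) : ¬e.IsDiag :=
  SimpleGraph.not_isDiag_of_mem_edgeSet _ (p.edges_subset_edgeSet he)

/-- **The odd-degree vertices of a trail are its two endpoints** (none if it is closed): the degree of
`x` in the bond set of a trail `p : u ⇝ v` is the number of edges of `p` containing `x`, whose parity is
given by Mathlib's `SimpleGraph.Walk.IsTrail.even_countP_edges_iff`. [folklore] -/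
theorem oddVertices_edges_toFinset_of_isTrail {G : SimpleGraph V} {u v : V} {p : G.Walk u v}
    (hp : p.IsTrail) : oddVertices p.edges.toFinset = ({u} : Finset V) ∆ {v} := by
  ext x
  rw [mem_oddVertices_iff]
  have hdeg : bondDegree p.edges.toFinset x = p.edges.countP (fun e => decide (x ∈ e)) := by
    rw [bondDegree, List.countP_eq_length_filter]
    have hfil : p.edges.toFinset.filter (fun e => x ∈ e ∧ ¬e.IsDiag) =
        (p.edges.filter fun e => decide (x ∈ e)).toFinset := by
      ext e
      simp only [Finset.mem_filter, List.mem_toFinset, List.mem_filter, decide_eq_true_eq]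
      exact ⟨fun h => ⟨h.1, h.2.1⟩, fun h => ⟨h.1, h.2, not_isDiag_of_mem_walk_edges p h.1⟩⟩
    rw [hfil, List.toFinset_card_of_nodup (hp.edges_nodup.filter _)]
  rw [hdeg, ← Nat.not_even_iff_odd, hp.even_countP_edges_iff x, Finset.mem_symmDiff,
    Finset.mem_singleton, Finset.mem_singleton]
  constructor
  · intro h
    by_cases hxu : x = u
    · subst hxu
      by_cases hxv : x = v
      · exact absurd (fun huv => absurd hxv huv) h
      · exact Or.inl ⟨rfl, hxv⟩
    · by_cases hxv : x = v
      · subst hxv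
        exact Or.inr ⟨rfl, hxu⟩
      · exact absurd (fun _ => ⟨hxu, hxv⟩) h
  · rintro (⟨rfl, hxv⟩ | ⟨rfl, hxu⟩)
    · exact fun h => (h hxv).1 rfl
    · exact fun h => (h (Ne.symm hxu)).2 rfl

open Classical in
/-- **Handshake on a cluster of a finite bond set.** For a finite set of pairs `T` and a vertex `a`,
the cluster of `a` in the graph of `T` contains an even number of odd-degree vertices of `T`: every
non-diagonal pair of `T` meets the cluster in `0` or `2` vertices. (The fact behind "a current with
sources `{x,y}` contains a path from `x` to `y`", Duminil-Copin 2016, §2.2.) [folklore] -/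
theorem even_card_oddVertices_filter_reachable (T : Finset (Sym2 V)) (a : V) :
    Even #((oddVertices T).filter fun u => (openGraph (↑T : Set (Sym2 V))).Reachable a u) := by
  classical
  -- the (finite) cluster of `a` among the vertices touched by `T`, together with `a`
  set S : Finset V := insert a (T.biUnion fun e => e.toFinset) with hS_def
  set C : Finset V := S.filter fun u => (openGraph (↑T : Set (Sym2 V))).Reachable a u with hC_def
  -- every vertex reachable from `a` and lying on a pair of `T`, or equal to `a`, is in `C`
  have hCmem : ∀ {u : V}, (openGraph (↑T : Set (Sym2 V))).Reachable a u → (u = a ∨ ∃ e ∈ T, u ∈ e) → u ∈ C := by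
    intro u hu hu'
    rw [hC_def, Finset.mem_filter, hS_def, Finset.mem_insert, Finset.mem_biUnion]
    refine ⟨?_, hu⟩
    rcases hu' with rfl | ⟨e, he, hue⟩
    · exact Or.inl rfl
    · exact Or.inr ⟨e, he, Sym2.mem_toFinset.2 hue⟩
  have hfilter : (oddVertices T).filter (fun u => (openGraph (↑T : Set (Sym2 V))).Reachable a u) =
      C.filter fun u => Odd (bondDegree T u) := by
    ext u
    simp only [Finset.mem_filter, mem_oddVertices_iff]
    constructor
    · rintro ⟨hodd, hreach⟩
      refine ⟨hCmem hreach (Or.inr ?_), hodd⟩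
      have hu := mem_oddVertices_iff.2 hodd
      simp only [oddVertices, Finset.mem_filter, Finset.mem_biUnion, Sym2.mem_toFinset] at hu
      exact hu.1
    · rintro ⟨huC, hodd⟩
      rw [hC_def, Finset.mem_filter] at huC
      exact ⟨hodd, huC.2⟩
  rw [hfilter, ← Finset.even_sum_iff_even_card_odd]
  -- double counting: `∑_{u ∈ C} deg_T(u) = ∑_{e ∈ T, e non-diagonal} #{u ∈ C : u ∈ e}`
  have hsum : ∑ u ∈ C, bondDegree T u =
      ∑ e ∈ T.filter (fun e => ¬e.IsDiag), #(C.filter fun u => u ∈ e) := by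
    simp only [bondDegree, Finset.card_eq_sum_ones, Finset.sum_filter]
    rw [Finset.sum_comm]
    refine Finset.sum_congr rfl fun e _ => ?_
    by_cases he : e.IsDiag <;> simp [he]
  rw [hsum]
  refine Finset.even_sum _ fun e he => ?_
  rw [Finset.mem_filter] at he
  obtain ⟨heT, hnd⟩ := he
  revert heT hnd
  induction e using Sym2.ind with
  | _ p q =>
    intro heT hnd
    have hpq : p ≠ q := fun h => hnd (Sym2.mk_isDiag_iff.2 h)
    have hadj : (openGraph (↑T : Set (Sym2 V))).Adj p q := by
      rw [openGraph_adj]; exact ⟨heT, hpq⟩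
    have hiff : p ∈ C ↔ q ∈ C := by
      constructor
      · intro hp
        have hp' := (Finset.mem_filter.1 hp).2
        exact hCmem (hp'.trans hadj.reachable) (Or.inr ⟨_, heT, Sym2.mem_mk_right p q⟩)
      · intro hq
        have hq' := (Finset.mem_filter.1 hq).2
        exact hCmem (hq'.trans hadj.symm.reachable) (Or.inr ⟨_, heT, Sym2.mem_mk_left p q⟩)
    have hfil : C.filter (fun u => u ∈ (s(p, q) : Sym2 V)) = ({p, q} : Finset V).filter (· ∈ C) := by
      ext u
      simp only [Finset.mem_filter, Sym2.mem_iff, Finset.mem_insert, Finset.mem_singleton]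
      tauto
    rw [hfil, Finset.filter_insert, Finset.filter_singleton]
    by_cases hp : p ∈ C
    · have hq : q ∈ C := hiff.1 hp
      rw [if_pos hp, if_pos hq, Finset.card_insert_of_notMem (by simpa using hpq)]
      simp
    · have hq : q ∉ C := fun hq => hp (hiff.2 hq)
      rw [if_neg hp, if_neg hq]
      simp

/-- **`𝓕_{{a}∆{b}} = {a ↔ b}`** as events on bond configurations (Duminil-Copin 2016, §2.2.2: "if
`A = {x,y}`, then `E ∈ 𝔉_A` if and only if `x` and `y` are in the same connected component of `E`";
the infinite-volume counterpart of the tree's `subcurrentEvent_pair`). `⊇`: the bonds of a simple open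
path from `a` to `b` have odd-degree vertices exactly `{a} ∆ {b}`
(`oddVertices_edges_toFinset_of_isTrail`); `⊆`: in the finite graph of `T` the cluster of the
odd vertex `a` contains evenly many odd vertices (`even_card_oddVertices_filter_reachable`), hence
contains `b`. [cite: DuminilCopin2016, §2.2.2] [cite: AizenmanDuminilCopinAnnals2021, Def. 3.2] -/
theorem traceSubcurrentEvent_pair (a b : V) :
    traceSubcurrentEvent (({a} : Finset V) ∆ {b}) = (openConn a b : Set (BondConfig V)) := by
  classical
  ext ω
  rw [mem_traceSubcurrentEvent_iff]
  change _ ↔ (openGraph ω).Reachable a b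
  constructor
  · rintro ⟨T, hTω, hTB⟩
    by_cases hab : a = b
    · subst hab; exact SimpleGraph.Reachable.refl a
    have ha : a ∈ oddVertices T := by
      rw [hTB, Finset.mem_symmDiff, Finset.mem_singleton, Finset.mem_singleton]
      exact Or.inl ⟨rfl, hab⟩
    have heven := even_card_oddVertices_filter_reachable T a
    -- the odd vertices in the cluster of `a` are among `{a, b}` and contain `a`; evenness forces `b`
    by_contra hnot
    have hTle : openGraph (↑T : Set (Sym2 V)) ≤ openGraph ω := openGraph_mono hTω
    have hfil : (oddVertices T).filter (fun u => (openGraph (↑T : Set (Sym2 V))).Reachable a u) = {a} := by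
      ext u
      rw [Finset.mem_filter, Finset.mem_singleton, hTB, Finset.mem_symmDiff, Finset.mem_singleton,
        Finset.mem_singleton]
      constructor
      · rintro ⟨hu | hu, hreach⟩
        · exact hu.1
        · exact absurd (hreach.mono hTle) (by rw [hu.1]; exact hnot)
      · rintro rfl
        exact ⟨Or.inl ⟨rfl, hab⟩, SimpleGraph.Reachable.refl _⟩
    rw [hfil, Finset.card_singleton] at heven
    exact Nat.not_even_one heven
  · intro h
    obtain ⟨p⟩ := h
    set q := p.toPath with hq
    refine ⟨(q : (openGraph ω).Walk a b).edges.toFinset, ?_, oddVertices_edges_toFinset_of_isTrail q.2.isTrail⟩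
    intro e he
    rw [Finset.mem_coe, List.mem_toFinset] at he
    have h' := (q : (openGraph ω).Walk a b).edges_subset_edgeSet he
    rw [openGraph, SimpleGraph.edgeSet_fromEdgeSet] at h'
    exact h'.1

end TraceSubcurrent

/-! ### Lifting from the box graphs to `ℤ^d` -/

section Box

variable (d : ℕ)

/-- `boxSources` commutes with symmetric differences. [folklore] -/
theorem boxSources_symmDiff (L : ℕ) (A B : Finset (Site d)) :
    boxSources d L (A ∆ B) = boxSources d L A ∆ boxSources d L B := by
  ext a
  simp only [mem_boxSources_iff, Finset.mem_symmDiff]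

/-- `boxSources` of a pair. [folklore] -/
theorem boxSources_pair (L : ℕ) (x y : BoxVertex d L) :
    boxSources d L (({(x : Site d)} : Finset (Site d)) ∆ {(y : Site d)}) = ({x} : Finset (BoxVertex d L)) ∆ {y} := by
  ext a
  simp only [mem_boxSources_iff, Finset.mem_symmDiff, Finset.mem_singleton, Subtype.ext_iff]

/-- For `A ⊆ Λ_{L+1}`, the sources read in the box map back onto `A`. [folklore] -/
theorem map_boxEmb_boxSources {L : ℕ} {A : Finset (Site d)} (hA : A ⊆ box d (L + 1)) :
    (boxSources d L A).map (boxEmb d L) = A := by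
  ext x
  simp only [Finset.mem_map, mem_boxSources_iff, boxEmb_apply]
  constructor
  · rintro ⟨a, ha, rfl⟩; exact ha
  · intro hx; exact ⟨⟨x, hA hx⟩, hx, rfl⟩

/-- Reading back a set of box vertices: `boxSources (S ↪ ℤ^d) = S`. [folklore] -/
theorem boxSources_map_boxEmb {L : ℕ} (S : Finset (BoxVertex d L)) :
    boxSources d L (S.map (boxEmb d L)) = S := by
  ext a
  simp only [mem_boxSources_iff, Finset.mem_map, boxEmb_apply]
  constructor
  · rintro ⟨b, hb, hba⟩
    rwa [← Subtype.ext hba]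
  · intro ha; exact ⟨a, ha, rfl⟩

/-- **The free box correlations of `ℤ^d` are those of the free box graph**: for `A ⊆ Λ_L`,
`⟨σ_A⟩⁰_{Λ_L;β,0} = ⟨σ_A⟩^{free}_{freeBoxGraph d L;β,0}` (both equal `Z⁰(A)/Z⁰(∅)`:
`isingCorr_free_box_eq` and the random-current representation on the box graph). [cite: AizenmanDuminilCopinSidoraviciusCMP2015, §2.1, eq. (2.7)] -/
theorem isingCorr_free_box_eq_boxGraph (L : ℕ) (β : ℝ) {A : Finset (Site d)} (hA : A ⊆ box d L) :
    isingCorr (zdGraph d) (box d L) β 0 .free A =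
      isingCorr (freeBoxGraph d L) univ β 0 .free (boxSources d L A) := by
  have h1 := isingCorr_free_box_eq d L β (boxSources_subset_boxCore hA)
  rw [map_boxSources hA] at h1
  rw [h1, plusCurrentSum_freeBoxGraph_eq_currentSum, plusCurrentSum_freeBoxGraph_eq_currentSum,
    isingCorr_free_eq_currentSum_div_holds (freeBoxGraph d L) β (boxSources d L A)]

/-- The free two-point functions of the box likewise. [cite: AizenmanDuminilCopinSidoraviciusCMP2015, §2.1, eq. (2.7)] -/
theorem isingTwoPoint_free_box_eq_boxGraph (L : ℕ) (β : ℝ) (x y : BoxVertex d L)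
    (hx : (x : Site d) ∈ box d L) (hy : (y : Site d) ∈ box d L) :
    isingTwoPoint (zdGraph d) (box d L) β 0 .free x y =
      isingTwoPoint (freeBoxGraph d L) univ β 0 .free x y := by
  have hsub : (({(x : Site d)} : Finset (Site d)) ∆ {(y : Site d)}) ⊆ box d L := by
    intro z hz
    rcases Finset.mem_symmDiff.1 hz with ⟨hz, -⟩ | ⟨hz, -⟩
    · rw [Finset.mem_singleton.1 hz]; exact hx
    · rw [Finset.mem_singleton.1 hz]; exact hy
  have h := isingCorr_free_box_eq_boxGraph d L β hsub
  rw [boxSources_pair] at h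
  simpa only [isingTwoPoint, isingCorr, spinPair_eq_spinProduct_symmDiff] using h

/-- An open path of lifted bonds starting in `Λ_{L+1}` pulls back to an open path of the box
configuration (every lifted bond has both endpoints in `Λ_{L+1}`). [folklore] -/
theorem reachable_of_reachable_liftBonds {L : ℕ} {ω : BondConfig (BoxVertex d L)} {u v : Site d}
    (h : (openGraph (liftBonds d L ω)).Reachable u v) (hu : u ∈ box d (L + 1)) :
    ∃ hv : v ∈ box d (L + 1), (openGraph ω).Reachable (⟨u, hu⟩ : BoxVertex d L) ⟨v, hv⟩ := by
  obtain ⟨p⟩ := h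
  induction p with
  | nil => exact ⟨hu, SimpleGraph.Reachable.refl _⟩
  | @cons u w v huw p ih =>
    rw [openGraph_adj] at huw
    obtain ⟨⟨e', he', he'eq⟩, hne⟩ := huw
    have hw : w ∈ box d (L + 1) := by
      have : w ∈ Sym2.map Subtype.val e' := by rw [he'eq]; exact Sym2.mem_mk_right u w
      obtain ⟨c, -, rfl⟩ := Sym2.mem_map.1 this
      exact c.2
    obtain ⟨hv, hreach⟩ := ih hw
    refine ⟨hv, SimpleGraph.Reachable.trans (SimpleGraph.Adj.reachable ?_) hreach⟩
    rw [openGraph_adj]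
    refine ⟨?_, fun h => hne (congrArg Subtype.val h)⟩
    have : e' = s((⟨u, hu⟩ : BoxVertex d L), ⟨w, hw⟩) := by
      apply Sym2.map.injective Subtype.val_injective
      rw [he'eq, Sym2.map_mk]
    rw [← this]
    exact he'

/-- **Lifting does not change connections**: for box vertices `x, z`, the lifted configuration
connects `↑x` to `↑z` in `ℤ^d` iff the box configuration connects `x` to `z`. [folklore] -/
theorem liftBonds_mem_openConn_iff {L : ℕ} (ω : BondConfig (BoxVertex d L)) (x z : BoxVertex d L) :
    liftBonds d L ω ∈ (openConn (x : Site d) (z : Site d) : Set (BondConfig (Site d))) ↔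
      ω ∈ (openConn x z : Set (BondConfig (BoxVertex d L))) := by
  change (openGraph (liftBonds d L ω)).Reachable x z ↔ (openGraph ω).Reachable x z
  constructor
  · intro h
    obtain ⟨_, h'⟩ := reachable_of_reachable_liftBonds d h x.2
    exact h'
  · exact reachable_liftBonds d

/-- The pull-back of the connection event `{x ↔ z}` of `ℤ^d` under the lifted trace of the sum is
the tree's `tracedConn (freeBoxGraph d L) x z` (ADC21's `{C_{n₁+n₂}(x) ∩ C_{n₁+n₂}(z) ≠ ∅}`,
`tracedClustersMeet_eq_tracedConn`). [folklore] -/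
theorem sourcedTrace_preimage_openConn {L : ℕ} (x z : BoxVertex d L) :
    sourcedTrace d L ⁻¹' (openConn (x : Site d) (z : Site d) : Set (BondConfig (Site d))) =
      tracedConn (freeBoxGraph d L) x z := by
  ext p
  rw [Set.mem_preimage, sourcedTrace]
  exact liftBonds_mem_openConn_iff d _ x z

/-- The image in `ℤ^d` of the bonds of the free box graph on which a current is odd. [folklore] -/
def oddBondsLift {L : ℕ} (m : Current (freeBoxGraph d L)) : Finset (Sym2 (Site d)) :=
  (univ.filter fun e₀ : (freeBoxGraph d L).edgeFinset => Odd (m e₀)).image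
    fun e₀ : (freeBoxGraph d L).edgeFinset => Sym2.map Subtype.val e₀.1

variable {d} in
/-- Membership in `oddBondsLift`. [folklore] -/
theorem mem_oddBondsLift_iff {L : ℕ} (m : Current (freeBoxGraph d L)) (e : Sym2 (Site d)) :
    e ∈ oddBondsLift d m ↔ ∃ e₀ : (freeBoxGraph d L).edgeFinset,
      Odd (m e₀) ∧ Sym2.map Subtype.val (e₀ : Sym2 (BoxVertex d L)) = e := by
  simp only [oddBondsLift, Finset.mem_image, Finset.mem_filter, Finset.mem_univ, true_and]

variable {d} in
/-- Lifted bonds of the box graph are not diagonal. [folklore] -/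
theorem not_isDiag_map_val_edge {L : ℕ} (e₀ : (freeBoxGraph d L).edgeFinset) :
    ¬(Sym2.map Subtype.val (e₀ : Sym2 (BoxVertex d L)) : Sym2 (Site d)).IsDiag := by
  obtain ⟨e₀, he₀⟩ := e₀
  induction e₀ using Sym2.ind with
  | _ a b =>
    have hab : a ≠ b := (freeBoxGraph d L).ne_of_adj (SimpleGraph.mem_edgeFinset.1 he₀)
    rw [Sym2.map_mk, Sym2.mk_isDiag_iff]
    exact fun h => hab (Subtype.ext h)

variable {d} in
/-- A box vertex lies on a lifted bond iff it lies on the bond. [folklore] -/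
theorem coe_mem_map_val_iff {L : ℕ} (e₀ : Sym2 (BoxVertex d L)) (v : BoxVertex d L) :
    (v : Site d) ∈ Sym2.map Subtype.val e₀ ↔ v ∈ e₀ := by
  rw [Sym2.mem_map]
  constructor
  · rintro ⟨c, hc, hcv⟩
    rwa [← Subtype.ext hcv]
  · intro hv; exact ⟨v, hv, rfl⟩

/-- **The odd-degree vertices of the lifted odd bonds of a current are its sources**:
`∂𝟙_{T} = ∂m` for `T = {e : m_e odd}` (the degree of `v` in `T` and `∑_{e ∋ v} m_e` have the same
parity). [cite: AizenmanDuminilCopinAnnals2021, Def. 3.1] -/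
theorem oddVertices_oddBondsLift {L : ℕ} (m : Current (freeBoxGraph d L)) :
    oddVertices (oddBondsLift d m) = m.sources.map (boxEmb d L) := by
  classical
  have hinj : Function.Injective fun e₀ : (freeBoxGraph d L).edgeFinset =>
      (Sym2.map Subtype.val e₀.1 : Sym2 (Site d)) := by
    intro e₁ e₂ h
    exact Subtype.ext (Sym2.map.injective Subtype.val_injective h)
  ext x
  rw [mem_oddVertices_iff, Finset.mem_map]
  by_cases hx : x ∈ box d (L + 1)
  · set v : BoxVertex d L := ⟨x, hx⟩ with hv
    -- the pairs of `T` through `x` are the lifts of the odd bonds through `v`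
    have hfil : (oddBondsLift d m).filter (fun e => x ∈ e ∧ ¬e.IsDiag) =
        (univ.filter fun e₀ : (freeBoxGraph d L).edgeFinset => Odd (m e₀) ∧ v ∈ (e₀ : Sym2 (BoxVertex d L))).image
          fun e₀ : (freeBoxGraph d L).edgeFinset => Sym2.map Subtype.val e₀.1 := by
      ext e
      simp only [Finset.mem_filter, mem_oddBondsLift_iff, Finset.mem_image, Finset.mem_univ, true_and]
      constructor
      · rintro ⟨⟨e₀, hodd, rfl⟩, hxe, -⟩
        exact ⟨e₀, ⟨hodd, (coe_mem_map_val_iff _ v).1 hxe⟩, rfl⟩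
      · rintro ⟨e₀, ⟨hodd, hve⟩, rfl⟩
        exact ⟨⟨e₀, hodd, rfl⟩, (coe_mem_map_val_iff _ v).2 hve, not_isDiag_map_val_edge e₀⟩
    have hdeg : bondDegree (oddBondsLift d m) x =
        #(univ.filter fun e₀ : (freeBoxGraph d L).edgeFinset => Odd (m e₀) ∧ v ∈ (e₀ : Sym2 (BoxVertex d L))) := by
      rw [bondDegree, hfil, Finset.card_image_of_injective _ hinj]
    have hsrc : v ∈ m.sources ↔ Odd (bondDegree (oddBondsLift d m) x) := by
      rw [Current.mem_sources_iff, Current.degree, Finset.odd_sum_iff_odd_card_odd, hdeg]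
      have : (univ.filter fun e₀ : (freeBoxGraph d L).edgeFinset =>
          Odd (if v ∈ (e₀ : Sym2 (BoxVertex d L)) then m e₀ else 0)) =
          univ.filter fun e₀ : (freeBoxGraph d L).edgeFinset => Odd (m e₀) ∧ v ∈ (e₀ : Sym2 (BoxVertex d L)) := by
        refine Finset.filter_congr fun e₀ _ => ?_
        by_cases h : v ∈ (e₀ : Sym2 (BoxVertex d L))
        · simp [h]
        · simp [h]
      rw [this]
    rw [← hsrc]
    constructor
    · intro h; exact ⟨v, h, rfl⟩
    · rintro ⟨w, hw, hwx⟩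
      have : w = v := Subtype.ext (by rw [hv]; exact hwx)
      rwa [← this]
  · -- `x ∉ Λ_{L+1}`: no lifted bond contains `x`, and `x` is not the image of a box vertex
    have hfil : (oddBondsLift d m).filter (fun e => x ∈ e ∧ ¬e.IsDiag) = ∅ := by
      refine Finset.filter_false_of_mem fun e he hxe' => ?_
      obtain ⟨hxe, -⟩ := hxe'
      obtain ⟨e₀, -, rfl⟩ := (mem_oddBondsLift_iff m e).1 he
      obtain ⟨c, -, hcx⟩ := Sym2.mem_map.1 hxe
      exact hx (hcx ▸ c.2)
    have h0 : bondDegree (oddBondsLift d m) x = 0 := by rw [bondDegree, hfil, Finset.card_empty]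
    rw [h0]
    constructor
    · intro h; exact absurd h (Nat.not_odd_iff_even.2 (by decide))
    · rintro ⟨w, -, rfl⟩; exact absurd w.2 hx

/-- The lifted odd bonds of a sub-current of `n₁ + n₂` lie in the lifted trace of the sum. [folklore] -/
theorem oddBondsLift_subset_sourcedTrace {L : ℕ} {m : Current (freeBoxGraph d L)}
    {p : Current (freeBoxGraph d L) × Current (freeBoxGraph d L)} (hm : m ≤ p.1 + p.2) :
    (↑(oddBondsLift d m) : Set (Sym2 (Site d))) ⊆ sourcedTrace d L p := by
  intro e he
  obtain ⟨e₀, hodd, rfl⟩ := (mem_oddBondsLift_iff m e).1 (Finset.mem_coe.1 he)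
  refine ⟨(e₀ : Sym2 (BoxVertex d L)), ?_, rfl⟩
  rw [Current.mem_traced_iff]
  exact lt_of_lt_of_le hodd.pos (hm e₀)

/-- **`𝓕_B` on the trace is `𝓕_B` on the currents** (ADC21 Def. 3.2 (iii), finite volume): for
`B ⊆ Λ_{L+1}`, a pair of currents of the free box graph has its lifted trace in
`traceSubcurrentEvent B` iff it admits a sub-current `m ≤ n₁ + n₂` with `∂m = B`
(`→`: `m = 𝟙_T` pulled back to the box graph; `←`: `T = ` the lifted odd bonds of `m`). [cite: AizenmanDuminilCopinAnnals2021, Def. 3.2] -/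
theorem sourcedTrace_preimage_traceSubcurrentEvent {L : ℕ} {B : Finset (Site d)}
    (hB : B ⊆ box d (L + 1)) :
    sourcedTrace d L ⁻¹' traceSubcurrentEvent B =
      subcurrentEvent (freeBoxGraph d L) (boxSources d L B) := by
  classical
  ext p
  rw [Set.mem_preimage, mem_traceSubcurrentEvent_iff, mem_subcurrentEvent_iff]
  constructor
  · rintro ⟨T, hTω, hTB⟩
    -- the sub-current `𝟙_T`, read on the box graph
    set m : Current (freeBoxGraph d L) := fun e₀ =>
      if Sym2.map Subtype.val (e₀ : Sym2 (BoxVertex d L)) ∈ T then 1 else 0 with hm_def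
    have hmle : m ≤ p.1 + p.2 := by
      intro e₀
      simp only [hm_def]
      split_ifs with h
      · obtain ⟨e₁, he₁, he₁eq⟩ := hTω h
        have : e₁ = (e₀ : Sym2 (BoxVertex d L)) := Sym2.map.injective Subtype.val_injective he₁eq
        rw [this] at he₁
        exact Nat.one_le_iff_ne_zero.2 (Nat.pos_iff_ne_zero.1 ((Current.mem_traced_iff _ e₀).1 he₁))
      · exact Nat.zero_le _
    -- its lifted odd bonds are `T`
    have hT : oddBondsLift d m = T := by
      ext e
      rw [mem_oddBondsLift_iff]
      constructor
      · rintro ⟨e₀, hodd, rfl⟩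
        by_contra h
        simp only [hm_def, if_neg h] at hodd
        exact (Nat.not_odd_iff_even.2 (by decide)) hodd
      · intro he
        obtain ⟨e₁, he₁, rfl⟩ := hTω he
        obtain ⟨h₁, -⟩ := he₁
        refine ⟨⟨e₁, h₁⟩, ?_, rfl⟩
        simp only [hm_def, if_pos he]
        exact odd_one
    refine ⟨m, hmle, ?_⟩
    have h := oddVertices_oddBondsLift d m
    rw [hT, hTB] at h
    rw [← boxSources_map_boxEmb d m.sources, ← h]
  · rintro ⟨m, hm, hms⟩
    refine ⟨oddBondsLift d m, oddBondsLift_subset_sourcedTrace d hm, ?_⟩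
    rw [oddVertices_oddBondsLift, hms, map_boxEmb_boxSources d hB]

end Box

/-! ### The finite-volume identities for the box trace laws (proved) -/

section FiniteVolume

variable (d : ℕ)

/-- Subsets of the box are subsets of the next box. [folklore] -/
theorem subset_box_succ_of_subset {L : ℕ} {A : Finset (Site d)} (hA : A ⊆ box d L) :
    A ⊆ box d (L + 1) :=
  hA.trans (box_subset_box_succ d L)

/-- **ADC21 (3.7) for the box trace law `P^{A∆B,∅}_{Λ_L,β}`, proved**: for `β ≥ 0` and
`A, B ⊆ Λ_L`,
`⟨σ_A⟩⁰_{Λ_L;β,0} ⟨σ_B⟩⁰_{Λ_L;β,0} = ⟨σ_{A∆B}⟩⁰_{Λ_L;β,0} · P^{A∆B,∅}_{Λ_L,β}[n̂₁ ∪ n̂₂ ∈ 𝓕_B]`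
(the tree's `isingCorr_mul_eq_doubleCurrent_subcurrent_holds` on the free box graph, transported by
`isingCorr_free_box_eq_boxGraph` and `sourcedTrace_preimage_traceSubcurrentEvent`). Product form: both
sides vanish when `⟨σ_{A∆B}⟩ = 0`. [cite: AizenmanDuminilCopinAnnals2021, eq. (3.7)] -/
theorem isingCorr_free_box_mul_eq (L : ℕ) {β : ℝ} (hβ : 0 ≤ β) {A B : Finset (Site d)}
    (hA : A ⊆ box d L) (hB : B ⊆ box d L) :
    isingCorr (zdGraph d) (box d L) β 0 .free A * isingCorr (zdGraph d) (box d L) β 0 .free B =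
      isingCorr (zdGraph d) (box d L) β 0 .free (A ∆ B) *
        (sourcedDoubleCurrentLaw d L β (A ∆ B) ∅).real (traceSubcurrentEvent B) := by
  have hAB : A ∆ B ⊆ box d L := fun x hx => by
    rcases Finset.mem_symmDiff.1 hx with ⟨h, -⟩ | ⟨h, -⟩
    · exact hA h
    · exact hB h
  rw [isingCorr_free_box_eq_boxGraph d L β hA, isingCorr_free_box_eq_boxGraph d L β hB,
    isingCorr_free_box_eq_boxGraph d L β hAB, boxSources_symmDiff,
    isingCorr_mul_eq_doubleCurrent_subcurrent_holds (freeBoxGraph d L) hβ (boxSources d L A) (boxSources d L B)]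
  congr 1
  rw [measureReal_def, measureReal_def,
    sourcedDoubleCurrentLaw_apply L β _ _ (measurableSet_traceSubcurrentEvent B),
    sourcedTrace_preimage_traceSubcurrentEvent d (subset_box_succ_of_subset d hB), boxSources_symmDiff,
    boxSources_empty]

/-- A symmetric difference of singletons of box sites lies in the box. [folklore] -/
theorem symmDiff_singleton_subset_box {L : ℕ} {a b : Site d} (ha : a ∈ box d L) (hb : b ∈ box d L) :
    (({a} : Finset (Site d)) ∆ {b}) ⊆ box d L := fun z hz => by
  rcases Finset.mem_symmDiff.1 hz with ⟨hz, -⟩ | ⟨hz, -⟩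
  · rw [Finset.mem_singleton.1 hz]; exact ha
  · rw [Finset.mem_singleton.1 hz]; exact hb

/-- **The pair form in the box**: for `β ≥ 0`, `A ⊆ Λ_L` and `a, b ∈ Λ_L`,
`⟨σ_A⟩⁰_{Λ_L} ⟨σ_aσ_b⟩⁰_{Λ_L} = ⟨σ_{A∆{a}∆{b}}⟩⁰_{Λ_L} · P^{A∆{a}∆{b},∅}_{Λ_L,β}[a ↔ b]`
(`𝓕_{{a}∆{b}} = {a ↔ b}`). [cite: AizenmanDuminilCopinAnnals2021, eq. (3.7) with Lemma 3.3] -/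
theorem isingCorr_free_box_mul_twoPoint_eq (L : ℕ) {β : ℝ} (hβ : 0 ≤ β) {A : Finset (Site d)}
    (hA : A ⊆ box d L) {a b : Site d} (ha : a ∈ box d L) (hb : b ∈ box d L) :
    isingCorr (zdGraph d) (box d L) β 0 .free A * isingTwoPoint (zdGraph d) (box d L) β 0 .free a b =
      isingCorr (zdGraph d) (box d L) β 0 .free (A ∆ ({a} ∆ {b})) *
        (sourcedDoubleCurrentLaw d L β (A ∆ ({a} ∆ {b})) ∅).real (openConn a b) := by
  have h := isingCorr_free_box_mul_eq d L hβ hA (symmDiff_singleton_subset_box d ha hb)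
  rw [traceSubcurrentEvent_pair] at h
  simpa only [isingTwoPoint, isingCorr, spinPair_eq_spinProduct_symmDiff] using h

/-- **ADC21 (3.11) for the box trace law `P^{{x}∆{y},{z}∆{t}}_{Λ_L,β}`, proved** (box-vertex form):
for `β ≥ 0` and vertices `x, y, z, t` of `Λ_L`,
`U₄,Λ_L(x,y,z,t) = -2 ⟨σ_xσ_y⟩⁰_{Λ_L}⟨σ_zσ_t⟩⁰_{Λ_L} · P^{{x}∆{y},{z}∆{t}}_{Λ_L,β}[x ↔ z]`, where
`U₄ = ⟨σ_xσ_yσ_zσ_t⟩ - ⟨σ_xσ_y⟩⟨σ_zσ_t⟩ - ⟨σ_xσ_z⟩⟨σ_yσ_t⟩ - ⟨σ_xσ_t⟩⟨σ_yσ_z⟩` (`connectedFour`)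
and `{x ↔ z} = {C(x) ∩ C(z) ≠ ∅}` (the tree's `ursellFour_eq_doubleCurrent_holds` on the free box
graph, transported along `isingTwoPoint_free_box_eq_boxGraph`, `isingCorr_free_box_eq_boxGraph` and
`sourcedTrace_preimage_openConn`). [cite: AizenmanDuminilCopinAnnals2021, eq. (3.11)] [cite: DuminilCopin2016, eq. (24)] -/
theorem connectedFour_free_box_eq' (L : ℕ) {β : ℝ} (hβ : 0 ≤ β) (x y z t : BoxVertex d L)
    (hx : (x : Site d) ∈ box d L) (hy : (y : Site d) ∈ box d L) (hz : (z : Site d) ∈ box d L)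
    (ht : (t : Site d) ∈ box d L) :
    connectedFour (isingMeasure (zdGraph d) (box d L) β 0 .free) spinAt
        ![(x : Site d), (y : Site d), (z : Site d), (t : Site d)] =
      -2 * isingTwoPoint (zdGraph d) (box d L) β 0 .free x y *
        isingTwoPoint (zdGraph d) (box d L) β 0 .free z t *
          (sourcedDoubleCurrentLaw d L β ({(x : Site d)} ∆ {(y : Site d)}) ({(z : Site d)} ∆ {(t : Site d)})).real
            (openConn (x : Site d) (z : Site d)) := by
  classical
  have hG := ursellFour_eq_doubleCurrent_holds (freeBoxGraph d L) hβ x y z t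
  -- the four-point function `⟨σ_xσ_yσ_zσ_t⟩ = ⟨σ_S⟩`, `S = {x}∆{y}∆{z}∆{t}`, transported
  have hS : (({(x : Site d)} : Finset (Site d)) ∆ ({(y : Site d)} ∆ ({(z : Site d)} ∆ {(t : Site d)}))) ⊆ box d L := by
    intro w hw
    simp only [Finset.mem_symmDiff, Finset.mem_singleton] at hw
    rcases hw with ⟨rfl, -⟩ | ⟨(⟨rfl, -⟩ | ⟨(⟨rfl, -⟩ | ⟨rfl, -⟩), -⟩), -⟩
    · exact hx
    · exact hy
    · exact hz
    · exact ht
  have hS' : boxSources d L (({(x : Site d)} : Finset (Site d)) ∆ ({(y : Site d)} ∆ ({(z : Site d)} ∆ {(t : Site d)}))) =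
      ({x} : Finset (BoxVertex d L)) ∆ ({y} ∆ ({z} ∆ {t})) := by
    ext a
    simp only [mem_boxSources_iff, Finset.mem_symmDiff, Finset.mem_singleton, Subtype.ext_iff]
  have h4 : isingExpect (zdGraph d) (box d L) β 0 .free
        (spinMonomial ![(x : Site d), (y : Site d), (z : Site d), (t : Site d)]) =
      isingExpect (freeBoxGraph d L) univ β 0 .free (spinMonomial ![x, y, z, t]) := by
    rw [spinMonomial_four_eq_spinProduct, spinMonomial_four_eq_spinProduct]
    have h := isingCorr_free_box_eq_boxGraph d L β hS
    rw [hS'] at h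
    exact h
  -- the measure of `{x ↔ z}`
  have hP : (sourcedDoubleCurrentLaw d L β ({(x : Site d)} ∆ {(y : Site d)}) ({(z : Site d)} ∆ {(t : Site d)})).real
        (openConn (x : Site d) (z : Site d)) =
      (doubleCurrentMeasure (freeBoxGraph d L) β ({x} ∆ {y}) ({z} ∆ {t})).real
        (tracedConn (freeBoxGraph d L) x z) := by
    rw [measureReal_def, measureReal_def,
      sourcedDoubleCurrentLaw_apply L β _ _ (measurableSet_openConn_holds (x : Site d) (z : Site d)),
      sourcedTrace_preimage_openConn d x z, boxSources_pair d L x y, boxSources_pair d L z t]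
  -- the two sides, term by term
  have hlhs : connectedFour (isingMeasure (zdGraph d) (box d L) β 0 .free) spinAt
        ![(x : Site d), (y : Site d), (z : Site d), (t : Site d)] =
      connectedFour (isingMeasure (freeBoxGraph d L) univ β 0 .free) spinAt ![x, y, z, t] := by
    simp only [connectedFour, nPoint_isingMeasure, twoPoint_isingMeasure, Matrix.cons_val_zero,
      Matrix.cons_val_one, Matrix.cons_val]
    rw [h4, isingTwoPoint_free_box_eq_boxGraph d L β x y hx hy, isingTwoPoint_free_box_eq_boxGraph d L β z t hz ht,
      isingTwoPoint_free_box_eq_boxGraph d L β x z hx hz, isingTwoPoint_free_box_eq_boxGraph d L β y t hy ht,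
      isingTwoPoint_free_box_eq_boxGraph d L β x t hx ht, isingTwoPoint_free_box_eq_boxGraph d L β y z hy hz]
  rw [hlhs, hG, hP, isingTwoPoint_free_box_eq_boxGraph d L β x y hx hy,
    isingTwoPoint_free_box_eq_boxGraph d L β z t hz ht]

/-- **ADC21 (3.11) for the box trace law, proved** (sites of `ℤ^d`): for `β ≥ 0` and
`x, y, z, t ∈ Λ_L`,
`U₄,Λ_L(x,y,z,t) = -2 ⟨σ_xσ_y⟩⁰_{Λ_L}⟨σ_zσ_t⟩⁰_{Λ_L} · P^{{x}∆{y},{z}∆{t}}_{Λ_L,β}[x ↔ z]`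
(`connectedFour_free_box_eq'`). [cite: AizenmanDuminilCopinAnnals2021, eq. (3.11)] [cite: DuminilCopin2016, eq. (24)] -/
theorem connectedFour_free_box_eq (L : ℕ) {β : ℝ} (hβ : 0 ≤ β) {x y z t : Site d}
    (hx : x ∈ box d L) (hy : y ∈ box d L) (hz : z ∈ box d L) (ht : t ∈ box d L) :
    connectedFour (isingMeasure (zdGraph d) (box d L) β 0 .free) spinAt ![x, y, z, t] =
      -2 * isingTwoPoint (zdGraph d) (box d L) β 0 .free x y *
        isingTwoPoint (zdGraph d) (box d L) β 0 .free z t *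
          (sourcedDoubleCurrentLaw d L β ({x} ∆ {y}) ({z} ∆ {t})).real (openConn x z) :=
  connectedFour_free_box_eq' d L hβ ⟨x, box_subset_box_succ d L hx⟩ ⟨y, box_subset_box_succ d L hy⟩
    ⟨z, box_subset_box_succ d L hz⟩ ⟨t, box_subset_box_succ d L ht⟩ hx hy hz ht

end FiniteVolume

/-! ### ADC21 (3.10)–(3.11) in infinite volume: the named facts -/

section InfiniteVolume

variable (d : ℕ)

/-- NAMED FACT — **the source-insertion identity in infinite volume** (Aizenman–Duminil-Copin 2021,
eq. (3.10): "Existing continuity results [AizDumSid15] permit to extend (3.7) to the infinite volume,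
expressed in terms of the weak limits of the random current measures `P^A_{Λ_n,β}` and
`P^{A_1,…,A_i}_{Λ_n,β}`, in the limit `Λ_n ↗ ℤ^d` … `⟨σ_A⟩_β⟨σ_B⟩_β / ⟨σ_Aσ_B⟩_β =
P^{A∆B,∅}_β[n₁+n₂ ∈ 𝓕_B]`", for `β ≤ β_c` (footnote 5: "for `β ≤ β_c` … `n₁+n₂` does not contain
infinite paths of positive currents, almost surely under `P^{A,B}_β` … [Aiz82] for `β < β_c` …
[AizDumSid15] for `β = β_c`")). Formal reading: nearest-neighbour ferromagnetic Ising model on `ℤ^d`,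
`d ≥ 2`, zero field, `0 ≤ β ≤ β_c(d)`; `⟨·⟩_β` is the free state `freeCorr d β 0` (the limit of the
free boundary condition with which `P^{A,B}_{Λ_L,β} = sourcedDoubleCurrentLaw` is built; for these `β`
it is the plus state whenever `m*(β) = 0`, in particular at `β_c` for `d ≥ 3`, see `.plusCorr_criticalBeta`); `P^{A∆B,∅}_β = sourcedDoubleCurrentLawInf
d β (A ∆ B) ∅` (a genuine probability measure for `0 < β` and `#(A∆B)` even, by the tree theorem
`exists_isSourcedDoubleCurrentLimit`; for `#(A∆B)` odd both sides vanish, `freeCorr_eq_zero_of_odd_card`);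
`σ_Aσ_B = σ_{A∆B}`; `𝓕_B = traceSubcurrentEvent B`; product form (no division: both sides vanish when
`⟨σ_{A∆B}⟩_β = 0`, e.g. `#(A∆B)` odd). The finite-volume identity is the theorem
`isingCorr_free_box_mul_eq`; the content of this fact is the passage `L → ∞` on the non-local event
`𝓕_B`. Users take `(h : freeCorr_mul_eq_sourcedDoubleCurrent_subcurrent d)`. [cite: AizenmanDuminilCopinAnnals2021, eq. (3.10)] -/
def freeCorr_mul_eq_sourcedDoubleCurrent_subcurrent : Prop :=
  2 ≤ d → ∀ ⦃β : ℝ⦄, 0 ≤ β → β ≤ criticalBeta d → ∀ A B : Finset (Site d),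
    freeCorr d β 0 A * freeCorr d β 0 B =
      freeCorr d β 0 (A ∆ B) * (sourcedDoubleCurrentLawInf d β (A ∆ B) ∅).real (traceSubcurrentEvent B)

/-- NAMED FACT — **Ursell's four-point function via sourced double currents, infinite volume**
(Aizenman–Duminil-Copin 2021, eq. (3.11): "Combining (3.10) for the different values of the product
of spin-spin correlations leads to `U₄^β(x,y,z,t) = -2⟨σ_xσ_y⟩_β⟨σ_zσ_t⟩_β
P^{xy,zt}_β[C_{n₁+n₂}(x) ∩ C_{n₁+n₂}(z) ≠ ∅]`. This equality is of fundamental importance … It was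
the basis of the analysis of [Aiz82]"; `U₄` is (1.21), `⟨σ_xσ_yσ_zσ_t⟩ - ⟨σ_xσ_y⟩⟨σ_zσ_t⟩ -
⟨σ_xσ_z⟩⟨σ_yσ_t⟩ - ⟨σ_xσ_t⟩⟨σ_yσ_z⟩`; same infinite-volume regime `β ≤ β_c` as (3.10)). Formal
reading: nearest-neighbour Ising model on `ℤ^d`, `d ≥ 2`, zero field, `0 ≤ β ≤ β_c(d)`, free (= unique)
state `freeExpect d β 0` on spin monomials (repetitions allowed); `P^{xy,zt}_β =
sourcedDoubleCurrentLawInf d β ({x}∆{y}) ({z}∆{t})` (pair sources written as symmetric differences, as in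
the tree's finite-volume `ursellFour_eq_doubleCurrent`, so coincident points are allowed); the event
`{C(x) ∩ C(z) ≠ ∅}` is `{x ↔ z} = openConn x z` (clusters of one configuration meet iff they coincide).
The finite-volume identity is the theorem `connectedFour_free_box_eq`; the content of this fact is the
passage `L → ∞` on the non-local event `{x ↔ z}` (footnote 5 of ADC21). Users take
`(h : freeUrsellFour_eq_sourcedDoubleCurrent d)`. [cite: AizenmanDuminilCopinAnnals2021, eq. (3.11)] -/
def freeUrsellFour_eq_sourcedDoubleCurrent : Prop :=
  2 ≤ d → ∀ ⦃β : ℝ⦄, 0 ≤ β → β ≤ criticalBeta d → ∀ x y z t : Site d,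
    freeExpect d β 0 (spinMonomial ![x, y, z, t]) -
        (freeExpect d β 0 (spinMonomial ![x, y]) * freeExpect d β 0 (spinMonomial ![z, t]) +
          freeExpect d β 0 (spinMonomial ![x, z]) * freeExpect d β 0 (spinMonomial ![y, t]) +
          freeExpect d β 0 (spinMonomial ![x, t]) * freeExpect d β 0 (spinMonomial ![y, z])) =
      -2 * freeExpect d β 0 (spinMonomial ![x, y]) * freeExpect d β 0 (spinMonomial ![z, t]) *
        (sourcedDoubleCurrentLawInf d β ({x} ∆ {y}) ({z} ∆ {t})).real (openConn x z)

variable {d}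

/-- For `β > 0` and source sets of even cardinality, **`P^{A,B}_β` is a probability measure**
(existence of the weak limit: the tree theorem `exists_isSourcedDoubleCurrentLimit`). [cite: AizenmanDuminilCopinAnnals2021, §3.2] -/
theorem isProbabilityMeasure_sourcedDoubleCurrentLawInf {β : ℝ} (hβ : 0 < β) {A B : Finset (Site d)}
    (hA : Even #A) (hB : Even #B) : IsProbabilityMeasure (sourcedDoubleCurrentLawInf d β A B) :=
  (isSourcedDoubleCurrentLimit_lawInf (exists_isSourcedDoubleCurrentLimit d hβ hA hB)).isProbabilityMeasure

/-- For `β > 0` and source sets of even cardinality, `P^{A,B}_{Λ_L,β}[S] → P^{A,B}_β[S]` for every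
local event `S`. [cite: AizenmanDuminilCopinAnnals2021, §3.2] -/
theorem tendsto_sourcedDoubleCurrentLaw_real_of_even {β : ℝ} (hβ : 0 < β) {A B : Finset (Site d)}
    (hA : Even #A) (hB : Even #B) {S : Set (BondConfig (Site d))} (hS : IsLocalEvent S) :
    Tendsto (fun L : ℕ => (sourcedDoubleCurrentLaw d L β A B).real S) atTop
      (𝓝 ((sourcedDoubleCurrentLawInf d β A B).real S)) :=
  tendsto_sourcedDoubleCurrentLaw_real (exists_isSourcedDoubleCurrentLimit d hβ hA hB) hS

/-- The spin monomial of a pair is the pair product `σ_x σ_y`. [folklore] -/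
theorem spinMonomial_two {V : Type*} (x y : V) : spinMonomial ![x, y] = spinPair x y := by
  funext s
  simp [spinMonomial, spinPair, Fin.prod_univ_two]

/-- The two-point factors of (3.11) are the pair correlations of (3.10):
`⟨σ_xσ_y⟩_β = ⟨σ_{{x}∆{y}}⟩_β` (`σ_x² = 1`). [folklore] -/
theorem freeExpect_spinMonomial_two_eq_freeCorr (β : ℝ) (x y : Site d) :
    freeExpect d β 0 (spinMonomial ![x, y]) = freeCorr d β 0 ({x} ∆ {y}) := by
  rw [spinMonomial_two, spinPair_eq_spinProduct_symmDiff]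
  rfl

/-- At `β_c` (`d ≥ 3`) the free state on spin monomials is the critical correlator `criticalCorr`
(the free-boundary-condition box limit, `criticalCorr_wellDefined_holds`). [cite: AizenmanDuminilCopinSidoraviciusCMP2015, Thm. 1.2] -/
theorem freeExpect_criticalBeta_spinMonomial (hd : 3 ≤ d) {n : ℕ} (u : Fin n → Site d) :
    freeExpect d (criticalBeta d) 0 (spinMonomial u) = criticalCorr d n u :=
  (criticalCorr_wellDefined_holds hd n u .free (by simp)).limUnder_eq

/-! #### Corollaries of (3.10) -/

/-- **The pair form of (3.10)** — the route's "weight-free ratio is a connection probability": for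
`d ≥ 2`, `0 ≤ β ≤ β_c(d)`, a finite `A` and sites `a, b`,
`⟨σ_A⟩_β ⟨σ_aσ_b⟩_β = ⟨σ_{A∆{a}∆{b}}⟩_β · P^{A∆{a}∆{b},∅}_β[a ↔ b in n̂₁ ∪ n̂₂]`
(`𝓕_{{a}∆{b}} = {a ↔ b}`, `traceSubcurrentEvent_pair`). [cite: AizenmanDuminilCopinAnnals2021, eq. (3.10) with Lemma 3.3] -/
theorem freeCorr_mul_eq_sourcedDoubleCurrent_subcurrent.pair
    (h : freeCorr_mul_eq_sourcedDoubleCurrent_subcurrent d) (hd : 2 ≤ d) {β : ℝ} (hβ : 0 ≤ β)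
    (hβc : β ≤ criticalBeta d) (A : Finset (Site d)) (a b : Site d) :
    freeCorr d β 0 A * freeCorr d β 0 ({a} ∆ {b}) =
      freeCorr d β 0 (A ∆ ({a} ∆ {b})) *
        (sourcedDoubleCurrentLawInf d β (A ∆ ({a} ∆ {b})) ∅).real (openConn a b) := by
  rw [← traceSubcurrentEvent_pair]
  exact h hd hβ hβc A ({a} ∆ {b})

/-- **The ratio form of (3.10)** (as printed, dividing by `⟨σ_Aσ_B⟩_β ≠ 0`):
`⟨σ_A⟩_β⟨σ_B⟩_β / ⟨σ_{A∆B}⟩_β = P^{A∆B,∅}_β[𝓕_B]`. [cite: AizenmanDuminilCopinAnnals2021, eq. (3.10)] -/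
theorem freeCorr_mul_eq_sourcedDoubleCurrent_subcurrent.div
    (h : freeCorr_mul_eq_sourcedDoubleCurrent_subcurrent d) (hd : 2 ≤ d) {β : ℝ} (hβ : 0 ≤ β)
    (hβc : β ≤ criticalBeta d) {A B : Finset (Site d)} (hAB : freeCorr d β 0 (A ∆ B) ≠ 0) :
    freeCorr d β 0 A * freeCorr d β 0 B / freeCorr d β 0 (A ∆ B) =
      (sourcedDoubleCurrentLawInf d β (A ∆ B) ∅).real (traceSubcurrentEvent B) := by
  rw [h hd hβ hβc A B, mul_div_cancel_left₀ _ hAB]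

/-- **(3.10) for the critical plus state, `d ≥ 3`**: at `β = β_c(d)` the free and plus states
coincide (`m*(β_c) = 0`, Aizenman–Duminil-Copin–Sidoravicius 2015, the tree theorems
`spontaneousMagnetization_criticalBeta_eq_zero_holds` and
`freeCorr_eq_plusCorr_of_spontaneousMagnetization_eq_zero`), so
`⟨σ_A⟩⁺_{β_c}⟨σ_B⟩⁺_{β_c} = ⟨σ_{A∆B}⟩⁺_{β_c} · P^{A∆B,∅}_{β_c}[𝓕_B]`. [cite: AizenmanDuminilCopinAnnals2021, eq. (3.10)] [cite: AizenmanDuminilCopinSidoraviciusCMP2015, Thm. 1.2] -/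
theorem freeCorr_mul_eq_sourcedDoubleCurrent_subcurrent.plusCorr_criticalBeta
    (h : freeCorr_mul_eq_sourcedDoubleCurrent_subcurrent d) (hd : 3 ≤ d) (A B : Finset (Site d)) :
    plusCorr d (criticalBeta d) 0 A * plusCorr d (criticalBeta d) 0 B =
      plusCorr d (criticalBeta d) 0 (A ∆ B) *
        (sourcedDoubleCurrentLawInf d (criticalBeta d) (A ∆ B) ∅).real (traceSubcurrentEvent B) := by
  have hβ : 0 ≤ criticalBeta d := criticalBeta_nonneg d
  have hm : spontaneousMagnetization d (criticalBeta d) = 0 :=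
    spontaneousMagnetization_criticalBeta_eq_zero_holds hd
  simp only [← freeCorr_eq_plusCorr_of_spontaneousMagnetization_eq_zero hβ hm]
  exact h (by omega) hβ le_rfl A B

/-- **The route's object** (CurrentConnectionInvariance; `d ≥ 3`, in particular `ℤ³`): at `β_c`,
`⟨σ_A⟩⁺ ⟨σ_aσ_b⟩⁺ = ⟨σ_{A∆{a}∆{b}}⟩⁺ · P^{A∆{a}∆{b},∅}_{β_c}[a ↔ b in n̂₁ ∪ n̂₂]`, so that the
weight-free ratio `⟨σ_A⟩⟨σ_aσ_b⟩/⟨σ_Aσ_aσ_b⟩` is the connection probability of the sourced double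
current. [cite: AizenmanDuminilCopinAnnals2021, eq. (3.10) with Lemma 3.3] -/
theorem freeCorr_mul_eq_sourcedDoubleCurrent_subcurrent.plusCorr_criticalBeta_pair
    (h : freeCorr_mul_eq_sourcedDoubleCurrent_subcurrent d) (hd : 3 ≤ d) (A : Finset (Site d))
    (a b : Site d) :
    plusCorr d (criticalBeta d) 0 A * plusCorr d (criticalBeta d) 0 ({a} ∆ {b}) =
      plusCorr d (criticalBeta d) 0 (A ∆ ({a} ∆ {b})) *
        (sourcedDoubleCurrentLawInf d (criticalBeta d) (A ∆ ({a} ∆ {b})) ∅).real (openConn a b) := by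
  rw [← traceSubcurrentEvent_pair]
  exact h.plusCorr_criticalBeta hd A ({a} ∆ {b})

/-- The spin monomial of an injective configuration is the spin product of its range (the same
statement as `spinMonomial_eq_spinProduct_image` of `PlanarIsingMultiPointLimits.lean`, repeated here
to avoid importing the planar-Ising cone). [folklore] -/
theorem spinMonomial_of_injective_eq_spinProduct {V : Type*} [DecidableEq V] {n : ℕ} {u : Fin n → V}
    (hu : Function.Injective u) : spinMonomial u = spinProduct (univ.image u) := by
  funext s
  unfold spinMonomial spinProduct
  rw [Finset.prod_image fun i _ j _ hij => hu hij]

/-- The spin monomial of an appended configuration factorises. [folklore] -/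
theorem spinMonomial_append {V : Type*} {m n : ℕ} (u : Fin m → V) (v : Fin n → V) :
    spinMonomial (Fin.append u v) = fun s => spinMonomial u s * spinMonomial v s := by
  funext s
  simp only [spinMonomial]
  rw [Fin.prod_univ_add]
  simp only [Fin.append_left, Fin.append_right]

/-- **(3.10) at `β_c` in the `criticalCorr` spelling of the route's cruxes** (`d ≥ 3`): for an
injective lattice configuration `u : Fin n → ℤ^d` and sites `a, b`,
`G_n(u) · G_2(a,b) = G_{n+2}(u,a,b) · P^{ran(u)∆{a}∆{b},∅}_{β_c}[a ↔ b]` with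
`G_m = criticalCorr d m`, the `(n+2)`-point configuration being `Fin.append u ![a, b]` (so that
`u = (· ∘ Fin.castAdd 2)` and `![a,b] = (· ∘ Fin.natAdd n)` of it, as in RatioInversionInvariance):
the weight-free ratio `G_n G_2 / G_{n+2}` is the sourced double-current connection probability.
[cite: AizenmanDuminilCopinAnnals2021, eq. (3.10) with Lemma 3.3] -/
theorem freeCorr_mul_eq_sourcedDoubleCurrent_subcurrent.criticalCorr_append
    (h : freeCorr_mul_eq_sourcedDoubleCurrent_subcurrent d) (hd : 3 ≤ d) {n : ℕ}
    {u : Fin n → Site d} (hu : Function.Injective u) (a b : Site d) :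
    criticalCorr d n u * criticalCorr d 2 ![a, b] =
      criticalCorr d (n + 2) (Fin.append u ![a, b]) *
        (sourcedDoubleCurrentLawInf d (criticalBeta d) ((univ.image u) ∆ ({a} ∆ {b})) ∅).real
          (openConn a b) := by
  classical
  have key := h.pair (by omega) (criticalBeta_nonneg d) le_rfl (univ.image u) a b
  have hmul : (fun s => spinProduct (univ.image u) s * spinProduct (({a} : Finset (Site d)) ∆ {b}) s) =
      spinProduct ((univ.image u) ∆ ({a} ∆ {b})) := by
    funext s
    exact spinProduct_mul_spinProduct _ _ s
  rw [← freeExpect_criticalBeta_spinMonomial hd, ← freeExpect_criticalBeta_spinMonomial hd,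
    ← freeExpect_criticalBeta_spinMonomial hd, spinMonomial_append, spinMonomial_of_injective_eq_spinProduct hu,
    spinMonomial_two, spinPair_eq_spinProduct_symmDiff, hmul]
  exact key

/-! #### Corollaries of (3.11) -/

/-- **(3.11) for the critical state, `d ≥ 3`, in the `criticalCorr` spelling of the summit**
(`criticalCorr d n u = ⟨∏ᵢ σ_{uᵢ}⟩⁺_{β_c}`; at `β_c` free = plus): with
`U₄(x,y,z,t) = criticalCorr d 4 ![x,y,z,t] - (G(x,y)G(z,t) + G(x,z)G(y,t) + G(x,t)G(y,z))`,
`G(u,v) = criticalCorr d 2 ![u,v]`,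
`U₄(x,y,z,t) = -2 G(x,y) G(z,t) · P^{{x}∆{y},{z}∆{t}}_{β_c}[x ↔ z]` — "two sourced clusters merge"
(route cruxes NormalisedU4Nonvanishing / FarMergingGivesU4). [cite: AizenmanDuminilCopinAnnals2021, eq. (3.11)] -/
theorem freeUrsellFour_eq_sourcedDoubleCurrent.criticalCorr_eq
    (h : freeUrsellFour_eq_sourcedDoubleCurrent d) (hd : 3 ≤ d) (x y z t : Site d) :
    criticalCorr d 4 ![x, y, z, t] -
        (criticalCorr d 2 ![x, y] * criticalCorr d 2 ![z, t] +
          criticalCorr d 2 ![x, z] * criticalCorr d 2 ![y, t] +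
          criticalCorr d 2 ![x, t] * criticalCorr d 2 ![y, z]) =
      -2 * criticalCorr d 2 ![x, y] * criticalCorr d 2 ![z, t] *
        (sourcedDoubleCurrentLawInf d (criticalBeta d) ({x} ∆ {y}) ({z} ∆ {t})).real (openConn x z) := by
  simp only [← freeExpect_criticalBeta_spinMonomial hd]
  exact h (by omega) (criticalBeta_nonneg d) le_rfl x y z t

/-- The (3.12)-type bound in infinite volume at `β_c` (`d ≥ 3`):
`|U₄(x,y,z,t)| ≤ 2 G(x,y) G(z,t) · P^{{x}∆{y},{z}∆{t}}_{β_c}[x ↔ z]`, given `G(x,y), G(z,t) ≥ 0`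
(Griffiths I, fed as hypotheses). [cite: AizenmanDuminilCopinAnnals2021, eq. (3.12)] -/
theorem freeUrsellFour_eq_sourcedDoubleCurrent.abs_criticalCorr_le
    (h : freeUrsellFour_eq_sourcedDoubleCurrent d) (hd : 3 ≤ d) (x y z t : Site d)
    (hxy : 0 ≤ criticalCorr d 2 ![x, y]) (hzt : 0 ≤ criticalCorr d 2 ![z, t]) :
    |criticalCorr d 4 ![x, y, z, t] -
        (criticalCorr d 2 ![x, y] * criticalCorr d 2 ![z, t] +
          criticalCorr d 2 ![x, z] * criticalCorr d 2 ![y, t] +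
          criticalCorr d 2 ![x, t] * criticalCorr d 2 ![y, z])| ≤
      2 * criticalCorr d 2 ![x, y] * criticalCorr d 2 ![z, t] *
        (sourcedDoubleCurrentLawInf d (criticalBeta d) ({x} ∆ {y}) ({z} ∆ {t})).real (openConn x z) := by
  rw [h.criticalCorr_eq hd, abs_mul, abs_mul, abs_mul, abs_of_nonneg hxy, abs_of_nonneg hzt,
    abs_of_nonneg (measureReal_nonneg (μ := _))]
  norm_num

end InfiniteVolume

end Literature.Probability.LatticeModels
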